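import Literature.NumberTheory.GaloisCohomology.LocalInvariantMap
import Literature.NumberTheory.GaloisRepresentations.CorestrictionTransitive
import Literature.NumberTheory.GaloisRepresentations.CorestrictionConjInvariant
import HarnessLib

/-!
# The local invariant map of an OPEN SUBGROUP of `Γ_{K_v}`: `inv_S := inv_v ∘ cor_{Γ_{K_v}/S}` on `H²(S, μₙ)`

Let `K` be a number field, `v` a finite place, `n ≥ 1`, and `S ≤ Γ_{K_v}` a closed subgroup of finite
index (the absolute Galois group of a finite extension `L/K_v` INSIDE `Γ_{K_v}`: `S = Gal(K̄_v/L)`). The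
invariant map of `L` read on the subgroup, without introducing the field `L` as a type, is

  `inv_S := inv_v ∘ cor_{Γ_{K_v}/S} : H²(S, μₙ(K̄)|_S) → ℤ/n`

(`localInvariantMap K n v` of `LocalInvariantMap.lean` — THE residue map `Prop121vii.invLevel` of
local class field theory — after the Shapiro corestriction `cor` of `Corestriction.lean`). That this IS
the invariant map of `L` is Serre, *Corps locaux*, XI §2 Prop. 1 (ii) (`inv_{K_v} ∘ Cor_{L/K_v} = inv_L`;
the tree's `Prop121vii.invLevel_corMu` in the field dialect); here it is taken as the DEFINITION in
the subgroup dialect, and the two structural laws a consumer needs are derived from the tree's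
corestriction calculus:

* `localInvariantMapSubgroup_cor` — **transitivity** `inv_S ∘ cor_{S/S'} = inv_{S'}` for closed
  finite-index `S' ≤ S` (`cor_cor_subgroupOf`, `CorestrictionTransitive.lean`);
* `localInvariantMapSubgroup_resH` — **`inv_S ∘ res_{Γ_{K_v}/S} = (Γ_{K_v} : S) · inv_v`**
  (`cor_resH`; Serre XIII §3 Prop. 7: `inv_L ∘ Res = [L : K_v] · inv_{K_v}`).

Conjugation invariance `inv_S ∘ (g ·) = inv_S` follows in the same way from `cor_conjMap_two`
(`CorestrictionConjInvariant.lean`) and is recorded there-after. Consumer: the finite-coefficient local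
Tate pairings along the layers `ℚ_{n,v}` of a `ℤ_p`-tower (K3 of the BSD cell; memo
`Cruxes/SignedKatoDivisibilityUpToAtTwo/W2G4-DLAYER-BLUEPRINT.md` §2 (A)). Definitions with bodies and
theorems; no named fact, no instance, no `sorry`.

## References
* J.-P. Serre, *Local Fields* (1979), XI §2 Prop. 1 (ii), XIII §3 Prop. 7. [SerreLocalFields1979]
* J.-P. Serre, *Galois Cohomology* (1997), I §2.5. [SerreGaloisCohomology1997]
* J. S. Milne, *Arithmetic Duality Theorems* (2006), I §1. [MilneADT2006]
-/

noncomputable section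

open CategoryTheory Function NumberField IsDedekindDomain

universe u

namespace Literature.NumberTheory.GaloisCohomology

open Literature.NumberTheory.GaloisRepresentations
open Literature.NumberTheory.GaloisRepresentations.DiscreteGaloisModule (mu MuCarrier)
open _root_.TopRep _root_.ContinuousCohomology

-- as in `LocalInvariantMap.lean` / `Corestriction.lean`: compactness of absolute Galois groups and of
-- closed subgroups are local instances only.
attribute [local instance] absoluteGaloisGroup_compactSpace compactSpace_of_isClosed_subgroup
  isClosed_subgroupOf_of_isClosed

variable (K : Type) [Field K] [NumberField K] (n : ℕ) [NeZero n] (v : HeightOneSpectrum (𝓞 K))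

/-- Shorthand: `μₙ(K̄)` as a discrete `Γ_{K_v}`-module (the coefficients of `localInvariantMap K n v`).
[cite: MilneADT2006, Ch. I §1] -/
abbrev muAt : DiscreteGaloisModule (v.adicCompletion K) (MuCarrier K n) :=
  (mu K n).toLocal (Sum.inr v : Place K)

variable (S : Subgroup (Field.absoluteGaloisGroup (v.adicCompletion K)))
  [hS : IsClosed (S : Set (Field.absoluteGaloisGroup (v.adicCompletion K)))]
  [Fintype (Field.absoluteGaloisGroup (v.adicCompletion K) ⧸ S)]

/-- **The local invariant map of the open subgroup `S ≤ Γ_{K_v}`**: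
`inv_S := inv_v ∘ cor_{Γ_{K_v}/S} : H²(S, μₙ(K̄)|_S) → ℤ/n` — the invariant map of the finite extension
`L = K̄_v^S` of `K_v`, in the subgroup dialect (Serre, *Corps locaux*, XI §2 Prop. 1 (ii):
`inv_{K_v} ∘ Cor_{L/K_v} = inv_L`). [cite: SerreLocalFields1979, XI §2 Prop. 1 (ii)] -/
def localInvariantMapSubgroup :
    (continuousCohomology 2 ((muAt K n v).restrict (subgroupIncl S)).toTopRep : Type) →+ ZMod n :=
  (localInvariantMap K n v).comp (cor S (muAt K n v) 2).hom.toLinearMap.toAddMonoidHom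

/-- Unfolding `inv_S = inv_v ∘ cor`. [cite: SerreLocalFields1979, XI §2 Prop. 1 (ii)] -/
theorem localInvariantMapSubgroup_apply
    (c : continuousCohomology 2 ((muAt K n v).restrict (subgroupIncl S)).toTopRep) :
    localInvariantMapSubgroup K n v S c = localInvariantMap K n v (cor S (muAt K n v) 2 c) := rfl

/-- **`inv_S ∘ res_{Γ_{K_v}/S} = (Γ_{K_v} : S) · inv_v`** (Serre, *Corps locaux*, XIII §3 Prop. 7:
`inv_L ∘ Res_{L/K_v} = [L : K_v] · inv_{K_v}`; from `cor ∘ res = (G : S)`, `cor_resH`).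
[cite: SerreLocalFields1979, XIII §3 Prop. 7] -/
theorem localInvariantMapSubgroup_resH (x : galoisCohomology (muAt K n v) 2) :
    localInvariantMapSubgroup K n v S (resH S (muAt K n v) 2 x) =
      S.index • localInvariantMap K n v x := by
  rw [localInvariantMapSubgroup_apply]
  have h := cor_resH S (muAt K n v) 1 x
  change (cor S (muAt K n v) 2) ((resH S (muAt K n v) 2) x) = S.index • x at h
  rw [h]
  exact map_nsmul (localInvariantMap K n v) S.index x

variable (S' : Subgroup (Field.absoluteGaloisGroup (v.adicCompletion K)))
  [hS' : IsClosed (S' : Set (Field.absoluteGaloisGroup (v.adicCompletion K)))]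
  [Fintype (Field.absoluteGaloisGroup (v.adicCompletion K) ⧸ S')] [Fintype (S ⧸ S'.subgroupOf S)]

/-- **Transitivity `inv_S ∘ cor_{S/S'} = inv_{S'}`** for closed finite-index `S' ≤ S ≤ Γ_{K_v}`
(`cor_{S/S'}` = the corestriction of the profinite group `↥S` along `S'.subgroupOf S`; the class on the
right is read in `H²(S', ·)` through `ofSubgroupOf`): Serre XI §2 Prop. 1 (ii) for the tower
`K̄_v^{S'} / K̄_v^S / K_v`, via `cor_cor_subgroupOf`. [cite: SerreLocalFields1979, XI §2 Prop. 1 (ii)] -/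
theorem localInvariantMapSubgroup_cor (h : S' ≤ S)
    (z : continuousCohomology 2 (repSub S S' (muAt K n v)).toTopRep) :
    localInvariantMapSubgroup K n v S (cor (S'.subgroupOf S) ((muAt K n v).restrict (subgroupIncl S)) 2 z) =
      localInvariantMapSubgroup K n v S' (ofSubgroupOf S S' (muAt K n v) h 2 z) := by
  exact congrArg (localInvariantMap K n v) (cor_cor_subgroupOf S S' (muAt K n v) h 2 z)

/-- **Conjugation invariance `inv_S ∘ (g ·) = inv_S`** for `S` closed NORMAL of finite index in
`Γ_{K_v}` and `g ∈ Γ_{K_v}` (the invariant map of the Galois extension `L = K̄_v^S` of `K_v` is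
`Gal(L/K_v)`-invariant: `inv_{gL} ∘ g_* = inv_L`; from `cor ∘ (g ·) = cor`, `cor_conjMap_two` of
`CorestrictionConjInvariant.lean`). [cite: SerreLocalFields1979, XI §2 Prop. 1 (ii)] -/
theorem localInvariantMapSubgroup_conjMap [S.Normal] (g : Field.absoluteGaloisGroup (v.adicCompletion K))
    (c : continuousCohomology 2 ((muAt K n v).restrict (subgroupIncl S)).toTopRep) :
    localInvariantMapSubgroup K n v S (conjMap (muAt K n v).toTopRep S g 2 c) =
      localInvariantMapSubgroup K n v S c :=
  congrArg (localInvariantMap K n v) (cor_conjMap_two S (muAt K n v) g c)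

end Literature.NumberTheory.GaloisCohomology
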